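import Mathlib
import Summits.KontsevichZagierPeriods.KontsevichZagierPeriods.Theorems.SoloInformedNashSimplex
import Summits.KontsevichZagierPeriods.KontsevichZagierPeriods.Theorems.SoloInformedRatJacobian
import Literature.NumberTheory.Transcendental.KZLogCalculusProofs
import Literature.NumberTheory.Transcendental.EllIterRepShuffle
import Literature.NumberTheory.Transcendental.SemialgebraicVolume
import HarnessLib
import HarnessLib.Audit

/-!
# SoloInformed — kit for the Möbius telescope (weight-3 Kaneko–Yamamoto identity by KZ moves)

Solo programme `solo-KontsevichZagierPeriods-informed`, session s45, line "the mixed Tate sector"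
(PART XVI). Generic tools on the open cube `(0,1)³` used by `SoloInformedTelescopeReps`,
`SoloInformedTelescopeMoves`, `SoloInformedZetaOneTwo`:

* `soloInformed_integrableOn_of_le_W3` — a continuous function on a measurable `D ⊆ (0,1)³`
  dominated by `C · ∏ᵢ (1 − xᵢ)^{−eᵢ}` with all `eᵢ < 1` is integrable on `D`;
* `soloInformed_one_div_one_sub_mul_le` — the weighted pair bound
  `1/(1 − yu) ≤ (1 − y)^{−α} (1 − u)^{−β}` (`α, β ≥ 0`, `α + β = 1`), from weighted AM–GM;
* `soloInformed_volume_zeroSet3` — the zero set of a non-zero `ℚ`-polynomial in `ℝ³` is null;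
* `soloInformed_integrableOn_image_polyMap_iff` / `…_ratMap_iff` — integrability is transported
  along an injective polynomial / rational change of variables (Mathlib's
  `integrableOn_image_iff_integrableOn_abs_det_fderiv_smul`).

References: M. Kontsevich, D. Zagier, *Periods* (2001), §1.2 [KontsevichZagier2001].
-/

noncomputable section

open MeasureTheory Set
open Literature.ModelTheory.ExponentialFields Literature.NumberTheory.Transcendental
open Literature.NumberTheory.Transcendental.KZ

namespace Summit.KontsevichZagierPeriods.KontsevichZagierPeriods.Theorems

/-! ## 1. The weight `∏ᵢ (1 − xᵢ)^{−eᵢ}` on the open cube -/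

/-- `(1 − t)^{−a}` is integrable on `(0,1)` for `a < 1`. [folklore] -/
theorem soloInformed_integrable_Ioo_one_sub_rpow {a : ℝ} (ha : a < 1) :
    Integrable (fun t : ℝ => (1 - t) ^ (-a)) ((volume : Measure ℝ).restrict (Ioo (0 : ℝ) 1)) := by
  have h := (intervalIntegral.intervalIntegrable_rpow' (a := (1 : ℝ)) (b := 0)
    (by linarith : (-1 : ℝ) < -a)).comp_sub_left 1
  simp only [sub_self, sub_zero] at h
  exact (intervalIntegrable_iff_integrableOn_Ioo_of_le zero_le_one).mp h

/-- The weight `W_e(x) = ∏ᵢ (1 − xᵢ)^{−eᵢ}` on `ℝ³`. -/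
def soloInformedW3 (e : Fin 3 → ℝ) (x : Fin 3 → ℝ) : ℝ := ∏ i, (1 - x i) ^ (-(e i))

/-- The weight written out. -/
theorem soloInformedW3_eq (e : Fin 3 → ℝ) (x : Fin 3 → ℝ) :
    soloInformedW3 e x = (1 - x 0) ^ (-(e 0)) * (1 - x 1) ^ (-(e 1)) * (1 - x 2) ^ (-(e 2)) := by
  simp [soloInformedW3, Fin.prod_univ_three]

/-- The weight is positive on the open cube. -/
theorem soloInformedW3_pos (e : Fin 3 → ℝ) {x : Fin 3 → ℝ} (hx : x ∈ soloInformedOpenCube 3) :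
    0 < soloInformedW3 e x :=
  Finset.prod_pos fun i _ => Real.rpow_pos_of_pos (by linarith [(hx i).2]) _

/-- **`W_e` is integrable on `(0,1)³` when every `eᵢ < 1`** (a product of one-dimensional
integrable weights). [folklore] -/
theorem soloInformed_integrableOn_W3 (e : Fin 3 → ℝ) (he : ∀ i, e i < 1) :
    IntegrableOn (soloInformedW3 e) (soloInformedOpenCube 3) := by
  have h : Integrable (fun x : Fin 3 → ℝ => ∏ i, (1 - x i) ^ (-(e i)))
      (Measure.pi fun _ : Fin 3 => (volume : Measure ℝ).restrict (Ioo (0 : ℝ) 1)) :=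
    Integrable.fintype_prod (f := fun i (t : ℝ) => (1 - t) ^ (-(e i)))
      fun i => soloInformed_integrable_Ioo_one_sub_rpow (he i)
  rw [IntegrableOn, soloInformedOpenCube_eq_pi, volume_pi, Measure.restrict_pi_pi]
  exact h

/-- The open cube `(0,1)³` is measurable. -/
theorem soloInformed_measurableSet_openCube3 : MeasurableSet (soloInformedOpenCube 3) := by
  rw [soloInformedOpenCube_eq_pi]
  exact MeasurableSet.univ_pi fun _ => measurableSet_Ioo

/-- **Domination criterion.** A function continuous on a measurable `D ⊆ (0,1)³` and bounded there
by `C · W_e` with all `eᵢ < 1` is integrable on `D`. [folklore] -/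
theorem soloInformed_integrableOn_of_le_W3 {D : Set (Fin 3 → ℝ)} (hD : MeasurableSet D)
    (hDc : D ⊆ soloInformedOpenCube 3) {f : (Fin 3 → ℝ) → ℝ} (hf : ContinuousOn f D)
    (e : Fin 3 → ℝ) (he : ∀ i, e i < 1) (C : ℝ)
    (hle : ∀ x ∈ D, |f x| ≤ C * soloInformedW3 e x) : IntegrableOn f D := by
  have hW : IntegrableOn (fun x => C * soloInformedW3 e x) D :=
    ((soloInformed_integrableOn_W3 e he).mono_set hDc).const_mul C
  refine Integrable.mono' hW (hf.aestronglyMeasurable hD) ?_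
  exact (ae_restrict_iff' hD).2 (ae_of_all _ fun x hx => by
    simpa [Real.norm_eq_abs] using hle x hx)

/-! ## 2. The weighted pair bound -/

/-- Weighted AM–GM on the unit square: `(1 − y)^α (1 − u)^{1−α} ≤ 1 − yu`. [folklore] -/
theorem soloInformed_gm_le_one_sub_mul {y u α : ℝ} (hy0 : 0 ≤ y) (hy1 : y ≤ 1) (hu0 : 0 ≤ u)
    (hu1 : u ≤ 1) (hα0 : 0 ≤ α) (hα1 : α ≤ 1) :
    (1 - y) ^ α * (1 - u) ^ (1 - α) ≤ 1 - y * u := by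
  have h := Real.geom_mean_le_arith_mean2_weighted hα0 (by linarith : 0 ≤ 1 - α)
    (by linarith : 0 ≤ 1 - y) (by linarith : 0 ≤ 1 - u) (by ring : α + (1 - α) = 1)
  nlinarith [mul_nonneg hα0 (mul_nonneg hy0 (by linarith : 0 ≤ 1 - u)),
    mul_nonneg (by linarith : 0 ≤ 1 - α) (mul_nonneg hu0 (by linarith : 0 ≤ 1 - y))]

/-- **`1/(1 − yu) ≤ (1 − y)^{−α} (1 − u)^{−β}`** on `[0,1)²` for weights `α, β ≥ 0`, `α + β = 1`.
[folklore] -/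
theorem soloInformed_one_div_one_sub_mul_le {y u α β : ℝ} (hy0 : 0 ≤ y) (hy1 : y < 1) (hu0 : 0 ≤ u)
    (hu1 : u < 1) (hα0 : 0 ≤ α) (hβ0 : 0 ≤ β) (hαβ : α + β = 1) :
    1 / (1 - y * u) ≤ (1 - y) ^ (-α) * (1 - u) ^ (-β) := by
  obtain rfl : β = 1 - α := by linarith
  have hg := soloInformed_gm_le_one_sub_mul hy0 hy1.le hu0 hu1.le hα0 (by linarith)
  have hpos : 0 < (1 - y) ^ α * (1 - u) ^ (1 - α) :=
    mul_pos (Real.rpow_pos_of_pos (by linarith) _) (Real.rpow_pos_of_pos (by linarith) _)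
  rw [Real.rpow_neg (by linarith), Real.rpow_neg (by linarith), ← mul_inv, one_div]
  exact inv_anti₀ hpos hg

/-- Monotonicity of a negative power: `1 − u ≤ 1 − w` gives `(1 − w)^{−c} ≤ (1 − u)^{−c}`
(`c ≥ 0`, `u < 1`). [folklore] -/
theorem soloInformed_rpow_neg_antitone {u w c : ℝ} (hu : u < 1) (hwu : w ≤ u) (hc : 0 ≤ c) :
    (1 - w) ^ (-c) ≤ (1 - u) ^ (-c) :=
  Real.rpow_le_rpow_of_nonpos (by linarith) (by linarith) (by linarith)

/-- Splitting a negative power: `(1 − t)^{−(a+b)} = (1 − t)^{−a} (1 − t)^{−b}` (`t < 1`). -/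
theorem soloInformed_rpow_neg_add {t a b : ℝ} (ht : t < 1) :
    (1 - t) ^ (-(a + b)) = (1 - t) ^ (-a) * (1 - t) ^ (-b) := by
  rw [neg_add, Real.rpow_add (by linarith)]

/-- `1/(1 − t) = (1 − t)^{−1}` as a real power (`t < 1`). -/
theorem soloInformed_one_div_eq_rpow_neg_one {t : ℝ} (ht : t < 1) :
    1 / (1 - t) = (1 - t) ^ (-(1 : ℝ)) := by
  rw [Real.rpow_neg (by linarith), Real.rpow_one, one_div]

/-! ## 3. Null walls -/

/-- The zero set in `ℝ³` of a non-zero polynomial with rational coefficients is null. [folklore] -/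
theorem soloInformed_volume_zeroSet3 (q : MvPolynomial (Fin 3) ℚ) (hq : q ≠ 0) :
    volume {x : Fin 3 → ℝ | MvPolynomial.aeval x q = 0} = 0 :=
  volume_setOf_aeval_eq_zero q fun h => hq
    (MvPolynomial.map_injective (algebraMap ℚ ℝ) (algebraMap ℚ ℝ).injective
      (by rw [h, map_zero]))

/-- A subset of the zero set of a non-zero rational polynomial is null. -/
theorem soloInformed_volume_eq_zero_of_subset_zeroSet3 {Z : Set (Fin 3 → ℝ)}
    (q : MvPolynomial (Fin 3) ℚ) (hq : q ≠ 0)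
    (hZ : ∀ x ∈ Z, (MvPolynomial.aeval x q : ℝ) = 0) : volume Z = 0 :=
  measure_mono_null (fun x hx => hZ x hx) (soloInformed_volume_zeroSet3 q hq)

/-! ## 4. Transport of integrability along a change of variables -/

/-- Integrability along an injective polynomial change of variables on a measurable set. -/
theorem soloInformed_integrableOn_image_polyMap_iff {n : ℕ} (P : Fin n → MvPolynomial (Fin n) ℚ)
    {s : Set (Fin n → ℝ)} (hs : MeasurableSet s) (hinj : InjOn (soloInformedPolyMap P) s)
    (g : (Fin n → ℝ) → ℝ) :
    IntegrableOn g (soloInformedPolyMap P '' s) ↔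
      IntegrableOn (fun x => |(soloInformedJacCLM P x).det| * g (soloInformedPolyMap P x)) s := by
  simpa [smul_eq_mul] using integrableOn_image_iff_integrableOn_abs_det_fderiv_smul volume hs
    (fun x _ => (soloInformed_hasFDerivAt_polyMap P x).hasFDerivWithinAt) hinj g

/-- Integrability along an injective rational change of variables on a measurable set off the
poles. -/
theorem soloInformed_integrableOn_image_ratMap_iff {n : ℕ} (P Q : Fin n → MvPolynomial (Fin n) ℚ)
    {s : Set (Fin n → ℝ)} (hs : MeasurableSet s)
    (hQ : ∀ j, ∀ x ∈ s, (MvPolynomial.aeval x (Q j) : ℝ) ≠ 0)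
    (hinj : InjOn (soloInformedRatMap P Q) s) (g : (Fin n → ℝ) → ℝ) :
    IntegrableOn g (soloInformedRatMap P Q '' s) ↔
      IntegrableOn (fun x => |(soloInformedRatJacCLM P Q x).det| * g (soloInformedRatMap P Q x)) s := by
  simpa [smul_eq_mul] using integrableOn_image_iff_integrableOn_abs_det_fderiv_smul volume hs
    (fun x hx => (soloInformed_hasFDerivAt_ratMap P Q x fun j => hQ j x hx).hasFDerivWithinAt) hinj g

/-! ## 5. Rule (2) packaged for rational maps -/

/-- **Rule (2) for a rational map with rational coefficients** off its poles. If `Ψ = P/Q` is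
injective on `r.domain`, the `Qⱼ` do not vanish there, `r'.domain = Ψ(r.domain)` and
`r.integrand = (r'.integrand ∘ Ψ) · |det J_Ψ|` on `r.domain`, then `[r] − [r'] ∈ relations`.
[Kontsevich–Zagier 2001, §1.2, rule (2)] -/
theorem soloInformed_of_sub_of_mem_relations_ratMap {n : ℕ} (P Q : Fin n → MvPolynomial (Fin n) ℚ)
    (r r' : IntegralRep n) (hQ : ∀ j, ∀ x ∈ r.domain, (MvPolynomial.aeval x (Q j) : ℝ) ≠ 0)
    (hinj : InjOn (soloInformedRatMap P Q) r.domain)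
    (hdom : r'.domain = soloInformedRatMap P Q '' r.domain)
    (hint : ∀ x ∈ r.domain, r.integrand x = r'.integrand (soloInformedRatMap P Q x) *
      |(soloInformedRatJacCLM P Q x).det|) :
    of r - of r' ∈ relations :=
  changeOfVariablesRel_subset_relations ⟨n, r, r', soloInformedRatMap P Q, soloInformedRatJacCLM P Q,
    soloInformed_isSemialgebraicMapOn_ratMap r.isSemialgebraic_domain P Q hQ,
    fun x hx => (soloInformed_hasFDerivAt_ratMap P Q x fun j => hQ j x hx).hasFDerivWithinAt,
    hinj, hdom, hint, rfl⟩

/-- **Rule (2) for a polynomial map with rational coefficients**, Jacobian factor written with the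
derivative `soloInformedJacCLM`. [Kontsevich–Zagier 2001, §1.2, rule (2)] -/
theorem soloInformed_of_sub_of_mem_relations_polyMapCLM {n : ℕ}
    (P : Fin n → MvPolynomial (Fin n) ℚ) (r r' : IntegralRep n)
    (hinj : InjOn (soloInformedPolyMap P) r.domain)
    (hdom : r'.domain = soloInformedPolyMap P '' r.domain)
    (hint : ∀ x ∈ r.domain, r.integrand x = r'.integrand (soloInformedPolyMap P x) *
      |(soloInformedJacCLM P x).det|) :
    of r - of r' ∈ relations :=
  changeOfVariablesRel_subset_relations ⟨n, r, r', soloInformedPolyMap P, soloInformedJacCLM P,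
    isSemialgebraicMapOn_aeval r.isSemialgebraic_domain P,
    fun u _ => (soloInformed_hasFDerivAt_polyMap P u).hasFDerivWithinAt, hinj, hdom, hint, rfl⟩

end Summit.KontsevichZagierPeriods.KontsevichZagierPeriods.Theorems
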